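import Literature.AlgebraicGeometry.Modules.ResolutionPropertyProjective
import Literature.AlgebraicGeometry.Modules.SerreTwistModCharts
import Literature.AlgebraicGeometry.Morphisms.CohAffineExactness
import HarnessLib

/-!
# An epimorphism from a quasi-coherent module onto a coherent module on a closed subscheme of `𝐏ʳ_A` is
# dominated by a finite locally free module (the lifting property of the resolution property; EGA I 9.4.9 + Serre)

For a closed immersion `ι : Z ↪ 𝐏ʳ_A`, an epimorphism `φ : M ↠ N` of `𝒪_Z`-modules with `M` affine-localizing
(quasi-coherent) and `N` coherent is DOMINATED by a finite sum of Serre twists: there are `m`, `K` and global sections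
`g_0, …, g_K ∈ Γ(Z, M(m))` with `𝒪_Z(-m)^{⊕(K+1)} → M → N` an epimorphism
(`SerreTwist.exists_epi_piPow_comp`; Hartshorne II 5.14 (b) for quasi-coherent `M` = the tree's
`SerreTheoremA.exists_forall_comp_eq`, plus `SerreTwistSum.epi_piPow`). Corollaries: the lifting property
`∃ E p, IsFiniteLocallyFree E ∧ Epi (p ≫ φ)` for closed subschemes of `𝐏ʳ_A`
(`exists_isFiniteLocallyFree_epi_comp_of_closedImmersion`), for projective `k`-schemes
(`IsProjectiveOver.exists_isFiniteLocallyFree_epi_comp`) and for abelian varieties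
(`AbelianVariety.exists_isFiniteLocallyFree_epi_comp`). This is the `hlift` input of the K-phase of
Thomason–Trobaugh 2.3.1 (d) for QUASI-COHERENT representatives. Also: naturality of `homOfTwistSection` and `piPow`
in the module (`homOfTwistSection_twistModMap`, `piPow_twistModMap`).
-/

noncomputable section

universe u

open CategoryTheory CategoryTheory.Limits AlgebraicGeometry TopologicalSpace Opposite
open Literature.AlgebraicGeometry.Morphisms Literature.AlgebraicGeometry.Morphisms.ProjCech
open Literature.AlgebraicGeometry.Motives

namespace Literature.AlgebraicGeometry.Modules

namespace SerreTwist

variable {A : Type u} [CommRing A] {r : ℕ} {Z : Scheme.{u}} (ι : Z ⟶ PP A r) {M N : Z.Modules} (φ : M ⟶ N) (m : ℕ)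

/-- **Naturality of `𝒪_Z(-m) ⟶ G` in `G`**: for `φ : M ⟶ N` and a global section `n` of `M(m)`, the morphism of
the image section `φ(m)(n) ∈ Γ(Z, N(m))` is the morphism of `n` followed by `φ` (both are computed chartwise,
`homOfTwistSection_app`, and `φ(m)` acts chartwise by `φ`, `comp_twistModMap_app`); i.e. twisting
`G ↦ G(m) = G ⊗ 𝒪(m)` is functorial and `Hom(𝒪(-m), G) = Γ(G(m))` naturally in `G`.
[cite: Hartshorne1977, II §5, Def. p. 117 and Prop. 5.12 (functoriality of the twist)] -/
theorem homOfTwistSection_twistModMap (n : Γ(twistMod ι M m, ⊤)) :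
    homOfTwistSection ι N m ((twistModMap ι φ m).app ⊤ n) = homOfTwistSection ι M m n ≫ φ := by
  refine Scheme.Modules.hom_ext _ _ fun U => ?_
  ext f
  change (homOfTwistSection ι N m ((twistModMap ι φ m).app ⊤ n)).app U f =
    φ.app U ((homOfTwistSection ι M m n).app U f)
  refine TopCat.Sheaf.eq_of_locally_eq' (⟨N.presheaf, N.isSheaf⟩ : TopCat.Sheaf Ab Z) (coverU ι U) U
    (fun j => homOfLE (inf_le_left : U ⊓ Zop ι {j.down} ≤ U)) (le_iSup_coverU ι U) _ _ fun j => ?_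
  have hV : U ⊓ Zop ι {j.down} ≤ Zop ι {j.down} := inf_le_right
  change N.presheaf.map (homOfLE (inf_le_left : U ⊓ Zop ι {j.down} ≤ U)).op
      ((homOfTwistSection ι N m ((twistModMap ι φ m).app ⊤ n)).app U f) =
    N.presheaf.map (homOfLE (inf_le_left : U ⊓ Zop ι {j.down} ≤ U)).op
      (φ.app U ((homOfTwistSection ι M m n).app U f))
  simp only [hom_map_app]
  rw [homOfTwistSection_app ι N m _ hV, homOfTwistSection_app ι M m _ hV, Scheme.Modules.Hom.app_smul,
    comp_twistModMap_app, hom_map_app]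

variable (g : ℕ → Γ(twistMod ι M m, ⊤))

/-- `piPow` is natural in the module: the summed morphism of the image sections `φ(m)(g_j)` is the summed morphism
of the `g_j` followed by `φ` (naturality of `Hom(𝒪(-m)^{⊕(K+1)}, G) = Γ(G(m))^{K+1}` in `G`).
[cite: Hartshorne1977, II §5, Def. p. 117 and Prop. 5.12 (functoriality of the twist)] -/
theorem piPow_twistModMap : ∀ K : ℕ,
    piPow ι N m (fun j => (twistModMap ι φ m).app ⊤ (g j)) K = piPow ι M m g K ≫ φ
  | 0 => homOfTwistSection_twistModMap ι φ m (g 0)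
  | K + 1 => by
    change biprod.desc _ _ = biprod.desc _ _ ≫ φ
    apply biprod.hom_ext'
    · rw [biprod.inl_desc, biprod.inl_desc_assoc, homOfTwistSection_twistModMap]
    · rw [biprod.inr_desc, biprod.inr_desc_assoc, piPow_twistModMap K]

/-! ### The lifting property -/

section Lifting

/-- **A quasi-coherent module mapping onto a coherent module on a closed subscheme of `𝐏ʳ_A` is dominated by a finite
locally free module**: for `ι : Z ↪ 𝐏ʳ_A` a closed immersion, `φ : M ↠ N` an epimorphism with `M` affine-localizing
(quasi-coherent) and `N` coherent, there are `m`, `K` and global sections `g_0, …, g_K` of `M(m)` such that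
`𝒪_Z(-m)^{⊕(K+1)} → M → N` is an epimorphism. Proof (Serre, FAC n° 66; Hartshorne II 5.14 (b) + 5.17 + 5.18; this
is the lifting property behind EGA I 9.4.9): lift finite generating families of the `Γ(Z_i, N)` (affine charts; `φ` is
surjective on affine sections since `ker φ` is quasi-coherent) to `Γ(Z_i, M)`, extend the lifts to global sections of
`M(m)` for `m ≫ 0` (`SerreTheoremA.exists_forall_comp_eq`, valid for AFFINE-LOCALIZING `M`), and observe that their
images in `N(m)` have chart values generating every `Γ(Z_i, N)` (`SerreTwistSum.epi_piPow`).
[cite: Hartshorne1977, II Lemma 5.14 (b) and Cor. 5.18 (p. 121)] [cite: SerreFAC1955, n° 66 Thm. 2] -/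
theorem exists_epi_piPow_comp [IsClosedImmersion ι] {M N : Z.Modules} (φ : M ⟶ N) [Epi φ]
    (hM : IsAffineLocalizing M) (hN : Coh N) :
    ∃ (m K : ℕ) (g : ℕ → Γ(twistMod ι M m, ⊤)), Epi (piPow ι M m g K ≫ φ) := by
  classical
  -- finite generating families on the affine charts, lifted to `M`
  choose S hS using fun i : Fin (r + 1) =>
    Module.finite_def.mp (hN.ft (isAffineOpen_Zop ι (Finset.singleton_nonempty i)))
  have hsurj : ∀ i : Fin (r + 1), Function.Surjective (φ.app (Zop ι {i})) := fun i =>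
    app_surjective_of_epi φ hM hN.loc (isAffineOpen_Zop ι (Finset.singleton_nonempty i))
  choose u hu using fun (i : Fin (r + 1)) (t : Γ(N, Zop ι {i})) => hsurj i t
  -- extension degrees of the lifts
  choose n₀ hn₀ using fun (i : Fin (r + 1)) (t : Γ(N, Zop ι {i})) => exists_forall_comp_eq ι M hM i (u i t)
  let m : ℕ := Finset.univ.sup fun i => (S i).sup (n₀ i)
  have hle : ∀ i, ∀ t ∈ S i, n₀ i t ≤ m := fun i t ht =>
    le_trans (Finset.le_sup (f := n₀ i) ht) (Finset.le_sup (f := fun i => (S i).sup (n₀ i)) (Finset.mem_univ i))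
  let T : Type u := Σ i : Fin (r + 1), (S i : Set Γ(N, Zop ι {i}))
  choose gT hgT using fun p : T => hn₀ p.1 p.2.1 m (hle p.1 p.2.1 p.2.2)
  let eT := Fintype.equivFin T
  let K : ℕ := Fintype.card T
  -- the family of global sections of `M(m)`, indexed by `ℕ` (zero beyond `K`)
  let gM : ℕ → Γ(twistMod ι M m, ⊤) := fun j =>
    if h : j < K + 1 then (Fin.cons 0 (fun k => gT (eT.symm k)) : Fin (K + 1) → _) ⟨j, h⟩ else 0
  refine ⟨m, K, gM, ?_⟩
  -- the images in `N(m)` generate every chart module, hence their summed morphism is an epimorphism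
  rw [← piPow_twistModMap ι φ m gM K]
  refine epi_piPow ι N m _ hN.loc K fun i t => ?_
  -- `t = Σ a_s s` with `s ∈ S i`, and `s = φ (u i s)` is the `i`-th chart value of the image of `gT ⟨i, s⟩`
  have htmem : t ∈ Submodule.span Γ(Z, Zop ι {i}) (S i : Set Γ(N, Zop ι {i})) := by rw [hS i]; trivial
  refine Submodule.span_induction (p := fun y _ => y ∈ _) ?_ ?_ ?_ ?_ htmem
  · intro s hs
    refine Submodule.subset_span ⟨(eT ⟨i, ⟨s, hs⟩⟩).succ, ?_⟩
    have hj : ((eT ⟨i, ⟨s, hs⟩⟩).succ : ℕ) < K + 1 := (eT ⟨i, ⟨s, hs⟩⟩).succ.2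
    dsimp only
    rw [comp_twistModMap_app]
    simp only [gM, dif_pos hj, Fin.eta, Fin.cons_succ, Equiv.symm_apply_apply]
    rw [hom_map_app, hgT ⟨i, ⟨s, hs⟩⟩ le_rfl, ← hom_map_app, hu]
    have h1 : homOfLE (le_refl (Zop ι {i})) = 𝟙 _ := rfl
    rw [h1, op_id, N.presheaf.map_id]
    rfl
  · exact Submodule.zero_mem _
  · intro a b _ _ ha hb
    exact Submodule.add_mem _ ha hb
  · intro c a _ ha
    exact Submodule.smul_mem _ _ ha

/-- **The lifting property of a closed subscheme of `𝐏ʳ_A`**: every epimorphism from a quasi-coherent module onto a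
coherent module is dominated by a finite locally free module (a sum of twists `𝒪_Z(-m)^{⊕(K+1)}`).
[cite: Hartshorne1977, II Cor. 5.18 (p. 121)] [cite: SerreFAC1955, n° 66 Thm. 2] -/
theorem exists_isFiniteLocallyFree_epi_comp_of_closedImmersion [IsClosedImmersion ι] {M N : Z.Modules}
    (φ : M ⟶ N) [Epi φ] (hM : IsAffineLocalizing M) (hN : Coh N) :
    ∃ (E : Z.Modules) (p : E ⟶ M), IsFiniteLocallyFree E ∧ Epi (p ≫ φ) := by
  obtain ⟨m, K, g, h⟩ := exists_epi_piPow_comp ι φ hM hN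
  exact ⟨Lpow ι m K, piPow ι M m g K, isFiniteLocallyFree_Lpow ι m K, h⟩

end Lifting

end SerreTwist

/-! ### Projective `k`-schemes and abelian varieties -/

section Projective

variable {k : Type u} [Field k]

/-- **The lifting property of a projective `k`-scheme**: every epimorphism from a quasi-coherent module onto a coherent
module is dominated by a finite locally free module. [cite: Hartshorne1977, II Cor. 5.18 (p. 121)] -/
theorem IsProjectiveOver.exists_isFiniteLocallyFree_epi_comp {X : SchemeOver k} (hX : IsProjectiveOver X)
    {M N : X.left.Modules} (φ : M ⟶ N) [Epi φ] (hM : IsAffineLocalizing M) (hN : Coh N) :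
    ∃ (E : X.left.Modules) (p : E ⟶ M), IsFiniteLocallyFree E ∧ Epi (p ≫ φ) := by
  obtain ⟨n, ι, hι⟩ := hX
  let ι' : X.left ⟶ PP k n := ι.left
  haveI : IsClosedImmersion ι' := hι
  exact SerreTwist.exists_isFiniteLocallyFree_epi_comp_of_closedImmersion ι' φ hM hN

/-- **The lifting property of an abelian variety**: every epimorphism from a quasi-coherent `𝒪_A`-module onto a
coherent one is dominated by a finite locally free module (abelian varieties are projective,
`AbelianVariety.isProjectiveOver_holds`). This is the `hlift` hypothesis of
`Modules/BoundedCoherentVBModelsOfRepresentative.exists_vbModel_of_qcRepresentative` on abelian varieties.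
[cite: Hartshorne1977, II Cor. 5.18 (p. 121)] [cite: MumfordAV1970, §6 Application 1 (p. 62)] -/
theorem AbelianVariety.exists_isFiniteLocallyFree_epi_comp (B : AbelianVariety k) {M N : B.X.left.Modules}
    (φ : M ⟶ N) [Epi φ] (hM : IsAffineLocalizing M) (hN : Coh N) :
    ∃ (E : B.X.left.Modules) (p : E ⟶ M), IsFiniteLocallyFree E ∧ Epi (p ≫ φ) :=
  IsProjectiveOver.exists_isFiniteLocallyFree_epi_comp (AbelianVariety.isProjectiveOver_holds B) φ hM hN

end Projective

end Literature.AlgebraicGeometry.Modules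

end
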